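import Mathlib
import HarnessLib
import Summits.Ventures.LatticeQCDFlow.Exactness.NCMCGeneralSpaceEventTauIntPositive

/-!
# Chord lemmas for the phase functional: trigonometric and planar bookkeeping behind the explicit `τ_int` floor for events

HONEST FRAMING: exact (Metropolis-corrected) sampling algorithms for lattice gauge theory;
figures of merit are autocorrelation/cost numbers at stated couplings and volumes; no
continuum-physics claim.

Venture `LatticeQCDFlow` (cell pub-lqcd), topic `Exactness`; FANOUT row 13 (`eng-snf`, GEN-21).
NEW WORK of the cell (elementary real analysis), not a published result; no definition is
introduced; nothing is cited as a fact.  Preparatory file for `NCMCGeneralSpaceEventTauIntFloor`,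
which makes GEN-21's qualitative `tauInt_setACF_pos_of_nHit` QUANTITATIVE by replacing the phase
`fract ∘ h` with the unit vector `(cos 2πh, sin 2πh)` and measuring, instead of exact rigidity, the
mean squared CHORD `4 sin²(π(h(y) − h(x) − q))` between consecutive phases.

## Content

* **`mul_sin_sq_add_le`** (the weighted
  triangle inequality `t sin²(a+b) ≤ t(1+t) sin² a + (1+t) sin² b`, `t ≥ 0`), `sin_sq_sub_indicator`
  (`sin²(x − kπ) = sin² x` for `k ∈ {0, 1}` in the form used), `four_sin_sq_le`
  (`4 sin²(π u) ≤ 4π² u²`).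
* `chord_sq_eq` (`(cos α − cos β)² + (sin α − sin β)² = 4 sin²((α − β)/2)`), `chord_sq_expand`
  (`= 2 − 2 cos β cos α − 2 sin β sin α`), `four_sin_sq_pi_eq` (`2 − 2cos(2πq) = 4 sin²(πq)`).
* planar algebra: `rot_sq_eq`, `sub_rot_sq_eq`, `integral_cos_add`,
  `integral_sin_add` (means of a rotated phase), `sq_integral_cos_add_sq_integral_sin_le_one`
  (`(∫cos θ)² + (∫sin θ)² ≤ 1` on a probability space).
* kernel bookkeeping for the chord observable `W_c(x, y) = 4 sin²(π(θ(y) − θ(x) − c))`: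
  `measurable_chord`, `measurable_chord_right`, `chord_nonneg`, `abs_chord_le`,
  `measurable_integral_chord`, `abs_integral_chord_le`, `integral_chord_nonneg`.

NOT CLAIMED: anything beyond bookkeeping.
-/

namespace Summit.Ventures.LatticeQCDFlow.Exactness.GeneralNCMC

open MeasureTheory ProbabilityTheory Set Filter Finset
open scoped ENNReal NNReal Topology

/-! ## §1 Trigonometric inequalities -/

section Trig

/-- **Weighted triangle inequality for chords**: `t sin²(a + b) ≤ t (1 + t) sin² a + (1 + t) sin² b`
for every `t ≥ 0` (through `|sin(a + b)| ≤ |sin a| + |sin b|`). -/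
theorem mul_sin_sq_add_le (a b : ℝ) {t : ℝ} (ht : 0 ≤ t) :
    t * Real.sin (a + b) ^ 2 ≤ t * (1 + t) * Real.sin a ^ 2 + (1 + t) * Real.sin b ^ 2 := by
  have h1 : |Real.sin (a + b)| ≤ |Real.sin a| + |Real.sin b| := by
    rw [Real.sin_add]
    calc |Real.sin a * Real.cos b + Real.cos a * Real.sin b|
        ≤ |Real.sin a * Real.cos b| + |Real.cos a * Real.sin b| := abs_add_le _ _
      _ = |Real.sin a| * |Real.cos b| + |Real.cos a| * |Real.sin b| := by rw [abs_mul, abs_mul]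
      _ ≤ |Real.sin a| * 1 + 1 * |Real.sin b| :=
          add_le_add (mul_le_mul_of_nonneg_left (Real.abs_cos_le_one b) (abs_nonneg _))
            (mul_le_mul_of_nonneg_right (Real.abs_cos_le_one a) (abs_nonneg _))
      _ = |Real.sin a| + |Real.sin b| := by ring
  have h2 : Real.sin (a + b) ^ 2 ≤ (|Real.sin a| + |Real.sin b|) ^ 2 := by
    rw [← sq_abs (Real.sin (a + b))]
    exact pow_le_pow_left₀ (abs_nonneg _) h1 2
  have h3 : |Real.sin a| ^ 2 = Real.sin a ^ 2 := sq_abs _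
  have h4 : |Real.sin b| ^ 2 = Real.sin b ^ 2 := sq_abs _
  have h5 : t * Real.sin (a + b) ^ 2 ≤ t * (|Real.sin a| + |Real.sin b|) ^ 2 :=
    mul_le_mul_of_nonneg_left h2 ht
  have key : t * (|Real.sin a| + |Real.sin b|) ^ 2
      = t * (1 + t) * |Real.sin a| ^ 2 + (1 + t) * |Real.sin b| ^ 2
        - (t * |Real.sin a| - |Real.sin b|) ^ 2 := by ring
  calc t * Real.sin (a + b) ^ 2 ≤ t * (|Real.sin a| + |Real.sin b|) ^ 2 := h5
    _ = t * (1 + t) * |Real.sin a| ^ 2 + (1 + t) * |Real.sin b| ^ 2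
        - (t * |Real.sin a| - |Real.sin b|) ^ 2 := key
    _ ≤ t * (1 + t) * |Real.sin a| ^ 2 + (1 + t) * |Real.sin b| ^ 2 := sub_le_self _ (sq_nonneg _)
    _ = t * (1 + t) * Real.sin a ^ 2 + (1 + t) * Real.sin b ^ 2 := by rw [h3, h4]

/-- `sin²(x − k π) = sin² x` for `k = 0` or `k = 1` (the two values of an indicator). -/
theorem sin_sq_sub_indicator (x k : ℝ) (hk : k = 0 ∨ k = 1) :
    Real.sin (x - k * Real.pi) ^ 2 = Real.sin x ^ 2 := by
  rcases hk with h | h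
  · rw [h, zero_mul, sub_zero]
  · rw [h, one_mul, Real.sin_sub_pi, neg_sq]

/-- `4 sin²(π u) ≤ 4 π² u²`. -/
theorem four_sin_sq_le (u : ℝ) : 4 * Real.sin (Real.pi * u) ^ 2 ≤ 4 * Real.pi ^ 2 * u ^ 2 := by
  have h := Real.sin_sq_le_sq (x := Real.pi * u)
  nlinarith [h]

/-- **The chord identity**: `(cos α − cos β)² + (sin α − sin β)² = 4 sin²((α − β)/2)`. -/
theorem chord_sq_eq (α β : ℝ) :
    (Real.cos α - Real.cos β) ^ 2 + (Real.sin α - Real.sin β) ^ 2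
      = 4 * Real.sin ((α - β) / 2) ^ 2 := by
  have h1 : (Real.cos α - Real.cos β) ^ 2 + (Real.sin α - Real.sin β) ^ 2
      = 2 - 2 * Real.cos (α - β) := by
    rw [Real.cos_sub]
    linear_combination Real.sin_sq_add_cos_sq α + Real.sin_sq_add_cos_sq β
  rw [h1, Real.sin_sq_eq_half_sub, show 2 * ((α - β) / 2) = α - β by ring]
  ring

/-- Expanded chord: `(cos α − cos β)² + (sin α − sin β)² = 2 − 2 cos β cos α − 2 sin β sin α`. -/
theorem chord_sq_expand (α β : ℝ) :
    (Real.cos α - Real.cos β) ^ 2 + (Real.sin α - Real.sin β) ^ 2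
      = 2 - 2 * (Real.cos β * Real.cos α) - 2 * (Real.sin β * Real.sin α) := by
  linear_combination Real.sin_sq_add_cos_sq α + Real.sin_sq_add_cos_sq β

/-- `2 − 2 cos(2 π q) = 4 sin²(π q)`. -/
theorem four_sin_sq_pi_eq (q : ℝ) : 2 - 2 * Real.cos (2 * Real.pi * q) = 4 * Real.sin (Real.pi * q) ^ 2 := by
  rw [Real.sin_sq_eq_half_sub, show 2 * (Real.pi * q) = 2 * Real.pi * q by ring]
  ring

end Trig

/-! ## §2 Planar algebra and means of a phase -/

section Planar

/-- A rotation preserves the squared norm. -/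
theorem rot_sq_eq (φ c s : ℝ) :
    (Real.cos φ * c - Real.sin φ * s) ^ 2 + (Real.sin φ * c + Real.cos φ * s) ^ 2 = c ^ 2 + s ^ 2 := by
  linear_combination (c ^ 2 + s ^ 2) * Real.sin_sq_add_cos_sq φ

/-- `|v − R_φ v|² = (2 − 2 cos φ) |v|²` for the rotation `R_φ` of the plane. -/
theorem sub_rot_sq_eq (φ c s : ℝ) :
    (c - (Real.cos φ * c - Real.sin φ * s)) ^ 2 + (s - (Real.sin φ * c + Real.cos φ * s)) ^ 2
      = (2 - 2 * Real.cos φ) * (c ^ 2 + s ^ 2) := by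
  linear_combination (c ^ 2 + s ^ 2) * Real.sin_sq_add_cos_sq φ

variable {S : Type*} [MeasurableSpace S]

/-- Mean cosine of a rotated phase: `∫ cos(θ + φ) dμ = cos φ ∫ cos θ dμ − sin φ ∫ sin θ dμ`. -/
theorem integral_cos_add (μ : Measure S) [IsFiniteMeasure μ] {θ : S → ℝ} (hθ : Measurable θ)
    (φ : ℝ) :
    ∫ x, Real.cos (θ x + φ) ∂μ
      = Real.cos φ * ∫ x, Real.cos (θ x) ∂μ - Real.sin φ * ∫ x, Real.sin (θ x) ∂μ := by
  have hc : Integrable (fun x => Real.cos φ * Real.cos (θ x)) μ :=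
    (Scoring.integrable_of_bounded μ (Real.measurable_cos.comp hθ)
      (fun x => Real.abs_cos_le_one _)).const_mul _
  have hs : Integrable (fun x => Real.sin φ * Real.sin (θ x)) μ :=
    (Scoring.integrable_of_bounded μ (Real.measurable_sin.comp hθ)
      (fun x => Real.abs_sin_le_one _)).const_mul _
  have he : (fun x => Real.cos (θ x + φ)) = fun x => Real.cos φ * Real.cos (θ x) - Real.sin φ * Real.sin (θ x) := by
    funext x; rw [Real.cos_add]; ring
  rw [he, integral_sub hc hs, integral_const_mul, integral_const_mul]

/-- Mean sine of a rotated phase: `∫ sin(θ + φ) dμ = sin φ ∫ cos θ dμ + cos φ ∫ sin θ dμ`. -/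
theorem integral_sin_add (μ : Measure S) [IsFiniteMeasure μ] {θ : S → ℝ} (hθ : Measurable θ)
    (φ : ℝ) :
    ∫ x, Real.sin (θ x + φ) ∂μ
      = Real.sin φ * ∫ x, Real.cos (θ x) ∂μ + Real.cos φ * ∫ x, Real.sin (θ x) ∂μ := by
  have hc : Integrable (fun x => Real.sin φ * Real.cos (θ x)) μ :=
    (Scoring.integrable_of_bounded μ (Real.measurable_cos.comp hθ)
      (fun x => Real.abs_cos_le_one _)).const_mul _
  have hs : Integrable (fun x => Real.cos φ * Real.sin (θ x)) μ :=
    (Scoring.integrable_of_bounded μ (Real.measurable_sin.comp hθ)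
      (fun x => Real.abs_sin_le_one _)).const_mul _
  have he : (fun x => Real.sin (θ x + φ)) = fun x => Real.sin φ * Real.cos (θ x) + Real.cos φ * Real.sin (θ x) := by
    funext x; rw [Real.sin_add]; ring
  rw [he, integral_add hc hs, integral_const_mul, integral_const_mul]

/-- **The mean phase vector lies in the unit disc**: `(∫ cos θ dμ)² + (∫ sin θ dμ)² ≤ 1` on a
probability space. -/
theorem sq_integral_cos_add_sq_integral_sin_le_one (μ : Measure S) [IsProbabilityMeasure μ]
    {θ : S → ℝ} (hθ : Measurable θ) :
    (∫ x, Real.cos (θ x) ∂μ) ^ 2 + (∫ x, Real.sin (θ x) ∂μ) ^ 2 ≤ 1 := by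
  have hcm : Measurable fun x => Real.cos (θ x) := Real.measurable_cos.comp hθ
  have hsm : Measurable fun x => Real.sin (θ x) := Real.measurable_sin.comp hθ
  have h1 := sq_integral_le_integral_sq μ hcm (B := 1) fun x => Real.abs_cos_le_one _
  have h2 := sq_integral_le_integral_sq μ hsm (B := 1) fun x => Real.abs_sin_le_one _
  have h3 : ∫ x, Real.cos (θ x) ^ 2 ∂μ + ∫ x, Real.sin (θ x) ^ 2 ∂μ = 1 := by
    rw [← integral_add (Scoring.integrable_of_bounded μ (hcm.pow_const 2) (C := 1) fun x => by
          rw [abs_pow]; exact pow_le_one₀ (abs_nonneg _) (Real.abs_cos_le_one _))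
        (Scoring.integrable_of_bounded μ (hsm.pow_const 2) (C := 1) fun x => by
          rw [abs_pow]; exact pow_le_one₀ (abs_nonneg _) (Real.abs_sin_le_one _))]
    have he : (fun x => Real.cos (θ x) ^ 2 + Real.sin (θ x) ^ 2) = fun _ => (1 : ℝ) := by
      funext x; rw [add_comm]; exact Real.sin_sq_add_cos_sq _
    rw [he, integral_const, probReal_univ, one_smul]
  linarith

end Planar

/-! ## §3 The chord observable `W_c(x, y) = 4 sin²(π(θ y − θ x − c))` -/

section Chord

variable {S : Type*} [MeasurableSpace S] {θ : S → ℝ}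

/-- Joint measurability of the chord observable. -/
theorem measurable_chord (hθ : Measurable θ) (c : ℝ) :
    Measurable fun p : S × S => 4 * Real.sin (Real.pi * (θ p.2 - θ p.1 - c)) ^ 2 :=
  ((Real.measurable_sin.comp ((((hθ.comp measurable_snd).sub (hθ.comp measurable_fst)).sub_const c
    ).const_mul _)).pow_const 2).const_mul _

/-- Measurability in the second variable. -/
theorem measurable_chord_right (hθ : Measurable θ) (c : ℝ) (x : S) :
    Measurable fun y : S => 4 * Real.sin (Real.pi * (θ y - θ x - c)) ^ 2 :=
  ((Real.measurable_sin.comp (((hθ.sub_const (θ x)).sub_const c).const_mul _)).pow_const 2).const_mul _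

omit [MeasurableSpace S] in
/-- The chord observable is non-negative. -/
theorem chord_nonneg (c : ℝ) (x y : S) : 0 ≤ 4 * Real.sin (Real.pi * (θ y - θ x - c)) ^ 2 :=
  mul_nonneg (by norm_num) (sq_nonneg _)

omit [MeasurableSpace S] in
/-- The chord observable is at most `4`. -/
theorem abs_chord_le (c : ℝ) (x y : S) : |4 * Real.sin (Real.pi * (θ y - θ x - c)) ^ 2| ≤ 4 := by
  rw [abs_of_nonneg (chord_nonneg c x y)]
  have h := Real.sin_sq_le_one (Real.pi * (θ y - θ x - c))
  linarith

/-- The kernel average of the chord observable is measurable in the base point. -/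
theorem measurable_integral_chord (η : Kernel S S) [IsMarkovKernel η] (hθ : Measurable θ) (c : ℝ) :
    Measurable fun x => ∫ y, 4 * Real.sin (Real.pi * (θ y - θ x - c)) ^ 2 ∂(η x) :=
  (StronglyMeasurable.integral_kernel_prod_right (κ := η)
    (f := fun x y => 4 * Real.sin (Real.pi * (θ y - θ x - c)) ^ 2)
    (measurable_chord hθ c).stronglyMeasurable).measurable

/-- The kernel average of the chord observable is bounded by `4`. -/
theorem abs_integral_chord_le (η : Kernel S S) [IsMarkovKernel η] (c : ℝ) (x : S) :
    |∫ y, 4 * Real.sin (Real.pi * (θ y - θ x - c)) ^ 2 ∂(η x)| ≤ 4 := by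
  rw [← Real.norm_eq_abs]
  calc ‖∫ y, 4 * Real.sin (Real.pi * (θ y - θ x - c)) ^ 2 ∂(η x)‖ ≤ 4 * (η x).real univ :=
        norm_integral_le_of_norm_le_const (Eventually.of_forall fun y => by
          rw [Real.norm_eq_abs]; exact abs_chord_le c x y)
    _ = 4 := by rw [probReal_univ, mul_one]

/-- The kernel average of the chord observable is non-negative. -/
theorem integral_chord_nonneg (η : Kernel S S) (c : ℝ) (x : S) :
    0 ≤ ∫ y, 4 * Real.sin (Real.pi * (θ y - θ x - c)) ^ 2 ∂(η x) :=
  integral_nonneg fun y => chord_nonneg c x y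

end Chord

end Summit.Ventures.LatticeQCDFlow.Exactness.GeneralNCMC
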